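import Literature.NumberTheory.DiophantineGeometry.AbelianSchemeModelOfSmoothProperModel
import Literature.NumberTheory.EllipticCurves.NeronModelAbelianSchemeProofs
import Literature.NumberTheory.EllipticCurves.NeronModelGroupStructure
import Mathlib.RingTheory.Henselian
import Mathlib.FieldTheory.IsSepClosed
import Mathlib.AlgebraicGeometry.Geometrically.Irreducible
import Literature.RingTheory.DiscreteValuationRing.StrictlyLocalExtension
import Literature.NumberTheory.DiophantineGeometry.KoizumiOfStrictlyLocal
import HarnessLib

/-!
**v2 (2026-08-28T12:03Z): `stub_W5_strictlyLocalCover` CLOSED BY NAME — `:= fun R _ _ _ => Literature.RingTheory.DiscreteValuationRing.exists_complete_dvr_faithfullyFlat_unramified_isAlgClosed R` ((W5) ★ p630952, B-p03); every v1 statement byte-identical; sorries 2 = {`stub_W0123_koizumi_strictlyLocal`, `stub_W4_koizumi_descends`}.**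
**v3 (2026-08-28T12:17Z): `stub_W4_koizumi_descends` CLOSED BY NAME — `:= Literature.NumberTheory.DiophantineGeometry.koizumi_of_koizumiStrictlyLocal_of_strictlyLocalCover` (junction ★ p632399, B-p12 lead over B-p05's core ★ p631524, A-p04 (W4b) ★ p631162, B-p03 (W5) ★ p630952, B-p18 §0b; B-p05 slot test a959c76c: zero adapters); every statement byte-identical; sorries 1 = {`stub_W0123_koizumi_strictlyLocal`} = the (W0)/(W1)/(W23) sub-line over a complete dvr with algebraically closed residue field.**
# `r0_koizumi` — road W skeleton for the booked fact `r₀` (crux workfile on item 24834, fan B-III (T1))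

Cell `hodgecm-mathlib`, B-plan1 (g4), 2026-08-28.  Director BATCH 116/117 (T1): r₀ =
`Literature.NumberTheory.DiophantineGeometry.exists_isAbelianSchemeModel_of_hasGoodReductionAt` (★ p617173, a NAMED FACT
on the floor: «a smooth proper model of the variety underlying an abelian variety over `𝓞_{K,v}` is — carries the structure
of — an abelian scheme», Koizumi 1960 / [BLR 1.2/8 + 5.1/5] / [BG 10.3.9]) becomes a THEOREM by ROAD W
(A-p11 READSECOND 212c257c (W0)–(W6); A-p06 READFIRST-W1 e52189d4; B6-SPEC §4.2; R0-SPEC §5):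
strictly-local cover (W5) → Koizumi over a STRICTLY LOCAL base {(W0) birational group law by the ω-argument,
(W1) Weil's group chunk theorem [BLR 5.1/5 = Artin 1986 (1.12)] — THE XL piece, (W2) ★ `weil_extension_of_codimOne`,
(W3) ★ p628607 purity} → (W4) fpqc descent of the group structure back to `𝓞_{K,v}` → (W6) packaging.

## v1 = the TOP LAYER, three registered stubs (typable today) + the kernel-checked composition `r0_of`
* `stub_W5_strictlyLocalCover` — every dvr has an injective faithfully flat unramified extension that is a COMPLETE dvr with
  algebraically closed residue field = the (W5) head of record verbatim (B-p03 `exists_complete_dvr_faithfullyFlat_unramified_isAlgClosed`,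
  `StrictlyLocalExtension.lean` over part 1 ★ p630471; closes BY NAME on landing).  The henselian / separably-closed cover ★ p629780 +
  A-p02 part II is the banked weaker cousin.  Size M–L (green, report-first 11:38:51Z).
* `stub_W0123_koizumi_strictlyLocal` — KOIZUMI OVER A COMPLETE STRICTLY LOCAL dvr `R′` (complete, algebraically closed residue field): a smooth proper `R′`-model of (the variety
  of) an abelian variety `A′/K′` carries a group-scheme structure for which the model's OWN generic identification is a
  group isomorphism.  = (W0)+(W1)+(W2)+(W3); its SUB-LINE `Lines/koizumi_strictly_local.lean` {stub_W0 (B-p18 head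
  `IntegralModel.IsSmoothProper.exists_birationalGroupLaw`), stub_W1 (A-p06 §1 `weil_groupChunk` over the W1-D vocabulary
  `StrictBirationalGroupLaw` / `IsRDense` / `IsGroupChunkSolution` — NOT typable before the definition file W1-D lands),
  stub_W23 (★ Weil extension + ★ purity ⇒ `𝒳′ ≅ G`)} is written the day W1-D is ★.  Size XL (W1 ≈ 1 800–2 700 l.).
* `stub_W4_koizumi_descends` — DESCENT: Koizumi over strictly local bases + the cover ⇒ Koizumi over `𝓞_{K,v}`
  (base-change bookkeeping of `IntegralModel`/`AbelianVariety` along `R → R′`, fpqc descent of the law / inverse / unit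
  by (W4) ★ p629684 `Literature.AlgebraicGeometry.Morphisms.openExtension_of_faithfullyFlat` (B-p12/B-p05), base-change bookkeeping (W4b, A-p04),
  group axioms by density ★ `hom_ext_of_dense`).  Size M–L.
* `r0_of` — REAL proof: the three stubs ⇒ `koizumi` (B-p19 0a2f0fea statement) ⇒ r₀ (B-p19's five-line term).
First rung (BC5): W1d of A-p06 §3 («an everywhere-defined strict law with a section on a smooth separated `𝒳` is a group
scheme», ≈ 200 l.) and (W3) ★ p628607 already landed.  Registry: published by `ledger crux write` + card ONLY (ρ1) — the
stub registry of item 24834 stays a2's.  After edition E-ST r₀ is no longer in the cone of `h21`; this line is BANKED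
CAPITAL for the Néron programme (`exists_isNeronModel_strictlyLocal` = (W0)+(W1)+★), not floor distance.
HC_CM is proved only modulo the 7 printed citations until rung 0 closes.
-/

noncomputable section

open CategoryTheory AlgebraicGeometry IsDedekindDomain IsDedekindDomain.HeightOneSpectrum
open scoped NumberField MonObj CategoryTheory.Obj

namespace HodgecmMathlib.R0.KoizumiLine

open Literature.AlgebraicGeometry.Motives Literature.NumberTheory.EllipticCurves
  Literature.NumberTheory.DiophantineGeometry

/-! ## The three statements the stubs are about (named `Prop`s, so `r0_of` is pure logic) -/

/-- **(W5) strictly-local cover of a dvr** — the (W5) head of record VERBATIM (B-p03 `Literature/RingTheory/DiscreteValuationRing/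
StrictlyLocalExtension.lean` :145 `exists_complete_dvr_faithfullyFlat_unramified_isAlgClosed`, over part 1 ★ p630471): every discrete valuation ring
`R` admits an injective, faithfully flat, unramified (`𝔪_R R′ = 𝔪_{R′}`) extension `R → R′` with `R′` a COMPLETE (hence henselian) discrete valuation
ring whose residue field is ALGEBRAICALLY closed.  (The weaker henselian / separably-closed cover is ★ p629780 + A-p02 part II; the sub-line may use
either, the stub carries the strongest cover the tree will hold so that (W1e) may work in the complete currency, B-p07.)
[Matsumura Thm 29.1 + completion; Artin 1986 Notation (4); BLR §2.3] -/
def StrictlyLocalCover : Prop :=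
  ∀ (R : Type) [CommRing R] [IsDomain R] [IsDiscreteValuationRing R],
    ∃ (R' : Type) (_ : CommRing R') (_ : IsDomain R') (_ : IsDiscreteValuationRing R') (_ : Algebra R R'),
      IsAdicComplete (IsLocalRing.maximalIdeal R') R' ∧ HenselianLocalRing R' ∧
        IsAlgClosed (IsLocalRing.ResidueField R') ∧ Module.FaithfullyFlat R R' ∧
        (algebraMap R R').FaithfullyFlat ∧ Function.Injective (algebraMap R R') ∧
        (IsLocalRing.maximalIdeal R).map (algebraMap R R') = IsLocalRing.maximalIdeal R'

/-- **Koizumi over a strictly local base** (= (W0)+(W1)+(W2)+(W3) of road W): for a complete (and henselian) dvr `R′` with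
algebraically closed residue field and fraction field `K′` (the STRONGEST base (W5) delivers — a weaker statement to prove; the sub-line's leaves
may of course be proved over any strictly henselian dvr, the ★ `exists_isNeronModel_strictlyLocal` spelling), an abelian variety `A′ / K′` and an integral model `𝒳′` of the variety
`A′.X` over `R′` that is smooth of relative dimension `dim A′`, proper, and has GEOMETRICALLY IRREDUCIBLE fibres (Mathlib
`GeometricallyIrreducible`, all fibres; B-p18 rider 11:47:56Z: (W0)/(W1)/(W23) consume it, general-dvr Zariski connectedness is not in the tree, and at
number-field places `stub_W4` supplies it from ★ `IntegralModel.geometricallyIrreducible_reductionAt_holds` + `A.geometricallyIntegral`, stable under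
base change), the total space carries a group-scheme
structure over `R′` for which the model's generic identification `𝒳′_{K′} ≅ A′.X` (read in the monoidal generic-fibre
functor `genericFibre R′ K′ = Over.pullback`, definitionally the model's `baseChange R′ K′`) is a homomorphism of group schemes
(«the group law of `A′` extends to `𝒳′`»).  [Koizumi1960 p. 377; BLR 1.2/8 + 5.1/5; Artin1986 (1.12); EdixhovenRomagny2012 3.28] -/
def KoizumiStrictlyLocal : Prop :=
  ∀ (R' : Type) [CommRing R'] [IsDomain R'] [IsDiscreteValuationRing R'] [HenselianLocalRing R']
    [IsAdicComplete (IsLocalRing.maximalIdeal R') R'], IsAlgClosed (IsLocalRing.ResidueField R') →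
    ∀ (K' : Type) [Field K'] [Algebra R' K'] [IsFractionRing R' K'] (A' : AbelianVariety K')
      (𝒳' : IntegralModel R' K' A'.X) [GeometricallyIrreducible 𝒳'.total.hom], 𝒳'.IsSmoothProper A'.dim →
      ∃ _ : GrpObj 𝒳'.total, IsMonHom (M := (genericFibre R' K').obj 𝒳'.total) (N := A'.X) 𝒳'.genericIso.hom

/-- **Koizumi at the finite places of number fields** (B-p19 0a2f0fea `koizumi_isAbelianSchemeModel_of_isSmoothProper`,
verbatim): a smooth proper integral model over `𝓞_{K,v}` of the variety underlying an abelian variety `A / K` carries a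
group-scheme structure making it an abelian-scheme model of `A` at `v`.  [Koizumi1960 p. 377; MumfordGIT 6.14 step 3] -/
def Koizumi : Prop :=
  ∀ {K : Type} [Field K] [NumberField K] (A : AbelianVariety K) (v : HeightOneSpectrum (𝓞 K))
    (𝒳 : IntegralModel (valuationSubringAtPrime K v) K A.X),
    𝒳.IsSmoothProper A.dim → ∃ _ : GrpObj 𝒳.total, IsAbelianSchemeModel A v 𝒳.total

/-! ## Registered stubs (v1 top layer) -/

/-- stub (W5): the complete strictly-local cover.  Closer of record: B-p03 `Literature.RingTheory.DiscreteValuationRing.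
exists_complete_dvr_faithfullyFlat_unramified_isAlgClosed` (`StrictlyLocalExtension.lean`, over part 1 ★ p630471); B-p19 second. -/
theorem stub_W5_strictlyLocalCover : StrictlyLocalCover :=
  fun R _ _ _ => Literature.RingTheory.DiscreteValuationRing.exists_complete_dvr_faithfullyFlat_unramified_isAlgClosed R

/-- stub (W0)+(W1)+(W2)+(W3): Koizumi over a complete strictly local dvr — the XL composite; sub-line `koizumi_strictly_local`
{W0 B-p18 (head 9e37e0ca), W1 A-p06 cut W1a–W1e over W1-D (W1d-core A-p14 bdb50226, W1e B-p07 complete currency), W23 A-p14,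
W6t transport} registered when W1-D (A-p06 report-first 11:45Z) lands. -/
theorem stub_W0123_koizumi_strictlyLocal : KoizumiStrictlyLocal := by
  sorry

/-- stub (W4)+(W6): descent of Koizumi along the strictly-local cover of `𝓞_{K,v}` and packaging
into `IsAbelianSchemeModel` — LEAD B-p12 (cut 11:40:38Z: descend the NÉRON MAPPING PROPERTY, not `m/i/e`: 𝒳′ abelian scheme ⇒ ★
`isNeronModel_of_isProper_of_smooth` ⇒ NMP over R′ ⇒ NMP over R by ★ p629684 §2 `existsUnique_extension_of_isPullback` (new leaf
`NeronMappingPropertyFpqcDescent.lean`) ⇒ `IsSchematicNeronModel` ⇒ ★ `IsSchematicNeronModel.exists_grp` ⇒ `IsAbelianSchemeModel`), over A-p04's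
(W4b) `IntegralModelBaseChange.lean` (base change of the model and of the abelian variety, fpqc descent of the structure morphisms
by (W4) ★ p629684 `openExtension_of_faithfullyFlat`, group axioms by density).  Engine ★; bookkeeping half (W4b) A-p04; composition open. -/
theorem stub_W4_koizumi_descends : KoizumiStrictlyLocal → StrictlyLocalCover → Koizumi :=
  Literature.NumberTheory.DiophantineGeometry.koizumi_of_koizumiStrictlyLocal_of_strictlyLocalCover

/-! ## The composition (kernel-checked, no `sorry`) -/

/-- Road W's top layer: the three stubs give Koizumi's theorem at number-field places. -/
theorem koizumi_of : StrictlyLocalCover → KoizumiStrictlyLocal →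
    (KoizumiStrictlyLocal → StrictlyLocalCover → Koizumi) → Koizumi :=
  fun h5 h0123 h4 => h4 h0123 h5

/-- **r₀ ⇐ the road-W stubs** — the booked fact `exists_isAbelianSchemeModel_of_hasGoodReductionAt` (★ p617173's
statement, by NAME) from the three stubs: the given smooth proper model is itself the abelian-scheme model
(B-p19 0a2f0fea `exists_isAbelianSchemeModel_of_hasGoodReductionAt_of_koizumi`). -/
theorem r0_of (h5 : StrictlyLocalCover) (h0123 : KoizumiStrictlyLocal)
    (h4 : KoizumiStrictlyLocal → StrictlyLocalCover → Koizumi) :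
    Literature.NumberTheory.DiophantineGeometry.exists_isAbelianSchemeModel_of_hasGoodReductionAt := by
  intro K _ _ A v hA
  obtain ⟨𝒳, h𝒳⟩ := hA
  obtain ⟨_, h𝒜⟩ := koizumi_of h5 h0123 h4 A v 𝒳 h𝒳
  exact ⟨𝒳.total, ‹_›, h𝒜⟩

/-- The line's head: r₀ from the registered stubs. -/
theorem r0_holds_of_stubs :
    Literature.NumberTheory.DiophantineGeometry.exists_isAbelianSchemeModel_of_hasGoodReductionAt :=
  r0_of stub_W5_strictlyLocalCover stub_W0123_koizumi_strictlyLocal stub_W4_koizumi_descends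

end HodgecmMathlib.R0.KoizumiLine

end
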